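import Summits.CriticalPhenomena.PercolationContinuityZ3.Theorems.PercNearOneGluingNoHeavyLowerTailHubPairTermGlue
import HarnessLib

/-!
# `NoHeavyLowerTail` (stmt-CriticalPhenomena-4575) — HUB PAIRS WITH A TERMINAL ALONE ON ITS SIDE, part 1b:
# event forms of the master separation rule (configurations `ω ⊆ DX ∪ DK`)

Support file (prover prim-gen-kcluster gen 72; `--supports stmt-CriticalPhenomena-4575`).  Pure graph combinatorics: no measures, no definitions,
no named facts, no sorries.  Continuation of `…HubPairTermGlue`: `sep_comm`, `mem_cl_sdiff_touch` (an open path inside one cluster avoids the pairs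
touching a disjoint cluster), `not_flag_of_joined`; and the event forms `c_mem_cl_iff`, `sep_iff_master`, `reachK_iff_of_J / _of_not_J` (reaching a
hub off `C(a)` inside the near side is a near-side event, the arm entering only through `J`).
-/

namespace Summit.CriticalPhenomena.PercolationContinuityZ3.Theorems

namespace HubPairTerm

open SimpleGraph Finset Literature.Probability.Percolation Literature.Probability.Percolation.Gladkov
open Literature.Probability.LatticeModels RefinedRowR3 ThreePointLB APL
open scoped Classical

variable {V : Type*} [Fintype V]

/-! ### Tools: separation is symmetric; an open path inside one cluster avoids another cluster -/

omit [Fintype V] in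
/-- `Sep` is symmetric in the two separated vertices. [folklore] -/
theorem sep_comm [Fintype V] {D : Finset (Sym2 V)} {W : Finset V} {u v : V} : Sep D W u v ↔ Sep D W v u := by
  unfold RefinedRowR3.Sep
  rw [mem_cl_comm]

/-- **An open path inside `C(x)` avoids the pairs touching a disjoint cluster**: if `y ∈ cl ζ x`, `ζ ⊆ D` and no vertex of `cl ζ x` lies in `U`,
then `y ∈ cl (D ∖ touch U) x`. [this work] -/
theorem mem_cl_sdiff_touch {ζ D : Finset (Sym2 V)} {U : Finset V} {x y : V} (hζ : ζ ⊆ D) (hU : ∀ t ∈ cl ζ x, t ∉ U)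
    (h : y ∈ cl ζ x) : y ∈ cl (D \ touch U) x := by
  have key : ∀ (u v : V) (p : (openGraph (↑ζ : Set (Sym2 V))).Walk u v), u ∈ cl ζ x →
      ((openGraph (↑(D \ touch U) : Set (Sym2 V))).Reachable u v ∧ v ∈ cl ζ x) := by
    intro u v p
    induction p with
    | nil => intro hu; exact ⟨Reachable.refl _, hu⟩
    | @cons u w v huw p' ih =>
      intro hu
      have hw : w ∈ cl ζ x := mem_cl_of_adj hu huw
      have h1 := huw
      rw [openGraph_adj, Finset.mem_coe] at h1
      obtain ⟨hr, hv⟩ := ih hw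
      refine ⟨(Adj.reachable ?_).trans hr, hv⟩
      rw [openGraph_adj, Finset.mem_coe, Finset.mem_sdiff, mem_touch]
      refine ⟨⟨hζ h1.1, ?_⟩, h1.2⟩
      rintro ⟨t, htU, hte⟩
      rcases Sym2.mem_iff.1 hte with rfl | rfl
      · exact hU _ hu htU
      · exact hU _ hw htU
  obtain ⟨p⟩ := mem_cl.1 h
  exact mem_cl.2 (key x y p (mem_cl_self _ _)).1

/-- **In state `C` the flag `N₁` fails**: if `c ∈ C_X(h₀)` and `h₁ ∉ C_X(h₀)` then `C_X(h₁)` does not separate `c` from `h₀` in `DX`. [this work] -/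
theorem not_flag_of_joined {ζX DX : Finset (Sym2 V)} {h₀ h₁ c : V} (hζ : ζX ⊆ DX) (hc : c ∈ cl ζX h₀) (h1 : h₁ ∉ cl ζX h₀) :
    ¬ Sep DX (cl ζX h₁) c h₀ := by
  unfold RefinedRowR3.Sep
  rw [not_not]
  refine mem_cl_comm.1 (mem_cl_sdiff_touch hζ (fun t ht htU => h1 ?_) hc)
  exact mem_cl_trans ht (mem_cl_comm.1 htU)

/-! ### Event forms for a configuration `ω ⊆ DX ∪ DK` -/

section Events

variable {DX DK : Finset (Sym2 V)} {a b c h₀ h₁ : V} (h01 : h₀ ≠ h₁) (hb0 : b ≠ h₀) (hb1 : b ≠ h₁) (hc0 : c ≠ h₀) (hc1 : c ≠ h₁)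
  (hbc : b ≠ c) (hca : c ≠ a)
  (hsepD : ∀ t : V, (∃ e ∈ DX, t ∈ e) → (∃ e ∈ DK, t ∈ e) → (t = h₀ ∨ t = h₁))
  (haX : ∀ e ∈ DX, a ∉ e) (hbX : ∀ e ∈ DX, b ∉ e) (hcK : ∀ e ∈ DK, c ∉ e)
  (hcX0 : c ∈ cl DX h₀) (hcX1 : c ∈ cl DX h₁)

include hsepD haX hcK hca in
/-- **`c ∈ C(a)` iff a hub of `C(a)` is joined to `c` inside the arm.** [this work] -/
theorem c_mem_cl_iff {ω : BondConfig V} (hω : ω ⊆ ↑DX ∪ ↑DK) :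
    c ∈ cl ω.toFinset a ↔
      ((h₀ ∈ cl ω.toFinset a ∧ (ω ∩ ↑DX) ∈ {η : BondConfig V | c ∈ cl η.toFinset h₀}) ∨
        (h₁ ∈ cl ω.toFinset a ∧ (ω ∩ ↑DX) ∈ {η : BondConfig V | c ∈ cl η.toFinset h₁})) := by
  simp only [Set.mem_setOf_eq]
  suffices key : ∀ ζX ζK : Finset (Sym2 V), (∀ e, e ∈ ζX ↔ e ∈ ω ∩ (↑DX : Set (Sym2 V))) →
      (∀ e, e ∈ ζK ↔ e ∈ ω \ (↑DX : Set (Sym2 V))) →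
      (c ∈ cl ω.toFinset a ↔ ((h₀ ∈ cl ω.toFinset a ∧ c ∈ cl ζX h₀) ∨ (h₁ ∈ cl ω.toFinset a ∧ c ∈ cl ζX h₁))) by
    refine key _ (ω \ (↑DX : Set (Sym2 V))).toFinset ?_ (fun e => by simp only [Set.mem_toFinset])
    intro e; simp only [Set.mem_toFinset]
  intro ζX ζK hX hK
  obtain ⟨hωζ, hXD, hKD, hsep⟩ := ApexTwoSum.blocks_of_eq hsepD hω hX hK
  rw [hωζ]
  have key := arm_mem_cl_iff (a := a) hsep (fun e he => haX e (hXD he)) (t := c) (fun e he => hcK e (hKD he)) hca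
  rw [key]
  constructor
  · rintro ⟨g, hg, hga, hcg⟩
    rcases hg with rfl | rfl
    · exact Or.inl ⟨hga, hcg⟩
    · exact Or.inr ⟨hga, hcg⟩
  · rintro (⟨hga, hcg⟩ | ⟨hga, hcg⟩)
    · exact ⟨_, Or.inl rfl, hga, hcg⟩
    · exact ⟨_, Or.inr rfl, hga, hcg⟩

include h01 hb0 hb1 hc0 hc1 hbc hsepD haX hbX hcK hcX0 hcX1 in
/-- **Master separation rule, event form.** [this work] -/
theorem sep_iff_master {ω : BondConfig V} (hω : ω ⊆ ↑DX ∪ ↑DK) :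
    Sep (DX ∪ DK) (cl ω.toFinset a) b c ↔
      ((h₀ ∈ cl ω.toFinset a ∨ h₀ ∉ cl (DK \ touch (cl ω.toFinset a)) b ∨
          (h₁ ∈ cl ω.toFinset a ∧ (ω ∩ ↑DX) ∈ {η : BondConfig V | Sep DX (cl η.toFinset h₁) c h₀})) ∧
        (h₁ ∈ cl ω.toFinset a ∨ h₁ ∉ cl (DK \ touch (cl ω.toFinset a)) b ∨
          (h₀ ∈ cl ω.toFinset a ∧ (ω ∩ ↑DX) ∈ {η : BondConfig V | Sep DX (cl η.toFinset h₀) c h₁}))) := by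
  simp only [Set.mem_setOf_eq]
  suffices key : ∀ ζX ζK : Finset (Sym2 V), (∀ e, e ∈ ζX ↔ e ∈ ω ∩ (↑DX : Set (Sym2 V))) →
      (∀ e, e ∈ ζK ↔ e ∈ ω \ (↑DX : Set (Sym2 V))) →
      (Sep (DX ∪ DK) (cl ω.toFinset a) b c ↔
        ((h₀ ∈ cl ω.toFinset a ∨ h₀ ∉ cl (DK \ touch (cl ω.toFinset a)) b ∨ (h₁ ∈ cl ω.toFinset a ∧ Sep DX (cl ζX h₁) c h₀)) ∧
          (h₁ ∈ cl ω.toFinset a ∨ h₁ ∉ cl (DK \ touch (cl ω.toFinset a)) b ∨ (h₀ ∈ cl ω.toFinset a ∧ Sep DX (cl ζX h₀) c h₁)))) by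
    refine key _ (ω \ (↑DX : Set (Sym2 V))).toFinset ?_ (fun e => by simp only [Set.mem_toFinset])
    intro e; simp only [Set.mem_toFinset]
  intro ζX ζK hX hK
  obtain ⟨hωζ, hXD, hKD, -⟩ := ApexTwoSum.blocks_of_eq hsepD hω hX hK
  rw [hωζ, sep_master h01 hb0 hb1 hc0 hc1 hbc hsepD hXD hKD haX hbX hcK hcX0 hcX1, sep_comm (u := h₀) (v := c),
    sep_comm (u := h₁) (v := c)]

include h01 hsepD haX in
/-- **Reaching a hub off `C(a)` inside the near side is a near-side event**, `J` holds: the arm is replaced by the pair `h₀h₁`. [this work] -/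
theorem reachK_iff_of_J {h : V} {ω : BondConfig V} (hω : ω ⊆ ↑DX ∪ ↑DK)
    (hJ : (ω ∩ ↑DX) ∈ {η : BondConfig V | h₁ ∈ cl η.toFinset h₀}) :
    h ∈ cl (DK \ touch (cl ω.toFinset a)) b ↔ insert s(h₀, h₁) (ω \ ↑DX) ∉ {η : BondConfig V | Sep DK (cl η.toFinset a) b h} := by
  simp only [Set.mem_setOf_eq] at hJ ⊢
  unfold RefinedRowR3.Sep
  rw [not_not]
  suffices key : ∀ ζX ζK ζ : Finset (Sym2 V), (∀ e, e ∈ ζX ↔ e ∈ ω ∩ (↑DX : Set (Sym2 V))) →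
      (∀ e, e ∈ ζK ↔ e ∈ ω \ (↑DX : Set (Sym2 V))) → (∀ e, e ∈ ζ ↔ e ∈ insert s(h₀, h₁) (ω \ (↑DX : Set (Sym2 V)))) →
      h₁ ∈ cl ζX h₀ → (h ∈ cl (DK \ touch (cl ω.toFinset a)) b ↔ h ∈ cl (DK \ touch (cl ζ a)) b) by
    refine key _ (ω \ (↑DX : Set (Sym2 V))).toFinset _ ?_ (fun e => by simp only [Set.mem_toFinset]) ?_ hJ
    · intro e; simp only [Set.mem_toFinset]
    · intro e; simp only [Set.mem_toFinset]
  intro ζX ζK ζ hX hK hζ hJζ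
  obtain ⟨hωζ, hXD, hKD, hsep⟩ := ApexTwoSum.blocks_of_eq hsepD hω hX hK
  have hζ' : ζ = {s(h₀, h₁)} ∪ ζK := by
    ext e; rw [hζ, Finset.mem_union, Finset.mem_singleton, hK, Set.mem_insert_iff]
  have hE : DK \ touch (cl ω.toFinset a) = DK \ touch (cl ζ a) := by
    rw [hωζ, hζ']
    ext f
    simp only [Finset.mem_sdiff, mem_touch, not_exists, not_and, and_congr_right_iff]
    intro hf
    have agree : ∀ t, t ∈ f → (t ∈ cl (ζX ∪ ζK) a ↔ t ∈ cl ({s(h₀, h₁)} ∪ ζK) a) := fun t htf =>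
      NetworkFold.mem_cl_replace hsep (NetworkFold.hsep_single ζK) (fun e he hae => absurd hae (haX e (hXD he)))
        (NetworkFold.not_inner_single a) (fun e he hte => hsepD t ⟨e, hXD he, hte⟩ ⟨f, hf, htf⟩) (NetworkFold.not_inner_single t)
        ⟨fun _ => NetworkFold.mem_cl_single h01, fun _ => hJζ⟩
    exact ⟨fun h1 t ht htf => h1 t ((agree t htf).2 ht) htf, fun h1 t ht htf => h1 t ((agree t htf).1 ht) htf⟩
  rw [hE]

include h01 hsepD haX in
/-- **Reaching a hub off `C(a)` inside the near side is a near-side event**, `J` fails: the arm is dropped. [this work] -/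
theorem reachK_iff_of_not_J {h : V} {ω : BondConfig V} (hω : ω ⊆ ↑DX ∪ ↑DK)
    (hJ : (ω ∩ ↑DX) ∉ {η : BondConfig V | h₁ ∈ cl η.toFinset h₀}) :
    h ∈ cl (DK \ touch (cl ω.toFinset a)) b ↔ (ω \ ↑DX) ∉ {η : BondConfig V | Sep DK (cl η.toFinset a) b h} := by
  simp only [Set.mem_setOf_eq] at hJ ⊢
  unfold RefinedRowR3.Sep
  rw [not_not]
  suffices key : ∀ ζX ζK : Finset (Sym2 V), (∀ e, e ∈ ζX ↔ e ∈ ω ∩ (↑DX : Set (Sym2 V))) →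
      (∀ e, e ∈ ζK ↔ e ∈ ω \ (↑DX : Set (Sym2 V))) → h₁ ∉ cl ζX h₀ →
      (h ∈ cl (DK \ touch (cl ω.toFinset a)) b ↔ h ∈ cl (DK \ touch (cl ζK a)) b) by
    refine key _ _ ?_ ?_ hJ
    · intro e; simp only [Set.mem_toFinset]
    · intro e; simp only [Set.mem_toFinset]
  intro ζX ζK hX hK hJζ
  obtain ⟨hωζ, hXD, hKD, hsep⟩ := ApexTwoSum.blocks_of_eq hsepD hω hX hK
  have hE : DK \ touch (cl ω.toFinset a) = DK \ touch (cl ζK a) := by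
    rw [hωζ]
    ext f
    simp only [Finset.mem_sdiff, mem_touch, not_exists, not_and, and_congr_right_iff]
    intro hf
    have agree : ∀ t, t ∈ f → (t ∈ cl (ζX ∪ ζK) a ↔ t ∈ cl ζK a) := fun t htf => by
      have e1 := NetworkFold.mem_cl_replace (ζX' := (∅ : Finset (Sym2 V))) hsep (fun z ⟨e, he, _⟩ _ => absurd he (Finset.notMem_empty e))
        (fun e he hae => absurd hae (haX e (hXD he))) (fun e he _ => absurd he (Finset.notMem_empty e))
        (fun e he hte => hsepD t ⟨e, hXD he, hte⟩ ⟨f, hf, htf⟩) (fun e he _ => absurd he (Finset.notMem_empty e))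
        ⟨fun h => absurd h hJζ, fun h => absurd h (NetworkFold.not_mem_cl_empty h01)⟩
      rwa [Finset.empty_union] at e1
    exact ⟨fun h1 t ht htf => h1 t ((agree t htf).2 ht) htf, fun h1 t ht htf => h1 t ((agree t htf).1 ht) htf⟩
  rw [hE]

end Events

end HubPairTerm

end Summit.CriticalPhenomena.PercolationContinuityZ3.Theorems
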